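import Summits.BirchSwinnertonDyer.Rank1Residual.X5.TwoAdicTargets
import Literature.NumberTheory.EllipticCurves.KatoRankBoundLevelZeroProofs
import Literature.NumberTheory.EllipticCurves.ComplexMultiplicationBurungaleFlachProofs
import Literature.NumberTheory.EllipticCurves.MordellWeilRankZeroProofs
import Literature.NumberTheory.EllipticCurves.MordellWeilTheoremProofs
import Literature.NumberTheory.EllipticCurves.PAdicHeightsRegulatorProofs
import Literature.NumberTheory.EllipticCurves.BSDShaProofs
import HarnessLib

/-!
# O1 (X5 at `p = 2`, non-CM): CALIBRATION of the `2`-adic BSD target in analytic rank `0`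

HONEST FRAMING (cell `b2b-bsdres`, run/shared/lean/b2b/bsd-rank1-residual/, verbatim in every
file): the goal of the cell is to DELETE the COMBINATION-SHAPED residual classes of the
Birch–Swinnerton-Dyer formula for ALL analytic-rank `≤ 1` elliptic curves over `ℚ` — "full BSD
formula for every rank `≤ 1` curve in class `C`" assembled STRICTLY from published theorems — so
that the rank-`≤ 1` remainder becomes exactly the CONSTRUCTION-SHAPED classes, which are TYPED
(missing-input `Prop`s), NOT attempted. This is not "finishing BSD". Research routes; no claim
beyond stated classes; census output = EVIDENCE, never a Literature fact; nothing here is booked;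
no mark of RESIDUAL-MAP §I moves.

Typer file 5 of the O1 class-closure folder (seat cc-typer-4). An E3 COMPARISON statement,
PROVED: on the rank-`0` rows of sub-cell O1-go (good ordinary `2`), the typed E1 target
`O1.TwoAdicBSD W D` (= Mazur–Tate–Teitelbaum's BSD(`2`) for the height datum `D`, tree
`PAdicBSDConjecture W 2 D`) is EQUIVALENT to the classical Birch–Swinnerton-Dyer formula
`#Ш(E/ℚ) = #Ш_an` (given `Ш` finite) — for every `D`, because in rank `0` no height enters
(`Reg₂(D) = 1`, `padicRegulator_eq_one_of_mordellWeilRank_eq_zero`) and the `2`-adic leading term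
IS the interpolated value `L₂(E,0) = (1 - α⁻¹)² · L(E,1)/Ω⁺_f` (tree theorem
`constantCoeff_padicLFunction_unitRoot`, Mazur–Tate–Teitelbaum 1986 §I.14 (14.3), every `p`), with
`1 - α⁻¹ ≠ 0` (`one_sub_unitRoot_inv_ne_zero`) and clause (i) `ord_{T=0} L₂ = 0 ⟺ r_an = 0`
(`order_padicLFunction_eq_zero_iff_analyticRank_eq_zero`). This is the kernel form of Disegni's
remark (Kyoto J. Math. 60 (2020) §3.2.1: in rank `0` the `p`-adic formula with `#Ш_an` "is
trivial unless the reduction is split multiplicative") and it says, for the census: on the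
`r = 0` good-ordinary-at-`2` rows the `2`-adic BSD check X8 is a CALIBRATION of the engine (it
tests `#Ш = #Ш_an`, the whole classical formula — not a `2`-adic refinement of it), so O1
information at those rows can only come from the ALGEBRAIC side (`O1.KatoDivisibilityAtTwoUpTo`,
control) or from descent. Nothing here is a Literature fact; nothing is booked.

References: [MazurTateTeitelbaum1986Invent] §I.14 (14.3), §II.10; [Disegni2020] §3.2.1;
[Miller2011LMS] §1 (`#Ш_an`).
-/

noncomputable section

open scoped Classical MatrixGroups ModularForm

open CongruenceSubgroup WeierstrassCurve Literature.NumberTheory.EllipticCurves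
  Literature.NumberTheory.EllipticCurves.ModularForms Literature.NumberTheory.EllipticCurves.Rank1Residual
  Literature.NumberTheory.EllipticCurves.Rank1Residual.Typed

set_option autoImplicit false

namespace Summit.BirchSwinnertonDyer.Rank1Residual.X5.O1

variable (W : WeierstrassCurve ℚ) [W.IsElliptic] [W.IsGloballyMinimal]

/-! ## §1 Rank zero: the `p`-adic regulator is `1` and `#Ш_an` is an explicit rational -/

omit [W.IsGloballyMinimal] in
/-- **In rank `0` the `p`-adic regulator of ANY height datum is `1`**: the Mordell–Weil basis is
empty (`exists_isMordellWeilBasis_holds` with `rank_ℤ E(ℚ) = 0`), the regulator does not depend on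
the basis (`IsMordellWeilBasis.padicRegulatorOf_eq_padicRegulator`), and an empty Gram determinant
is `1`. Mazur–Tate–Teitelbaum 1986 §II.4. [cite: MazurTateTeitelbaum1986Invent, §II.4] -/
theorem padicRegulator_eq_one_of_mordellWeilRank_eq_zero (p : ℕ) [Fact p.Prime]
    (hr : W.mordellWeilRank = 0) (D : PAdicHeightData W p) : padicRegulator D = 1 := by
  obtain ⟨P, hP⟩ :
      ∃ P : Fin W.mordellWeilRank → W.toAffine.Point, IsMordellWeilBasis P :=
    W.exists_isMordellWeilBasis_holds
  rw [← hP.padicRegulatorOf_eq_padicRegulator D, padicRegulatorOf]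
  haveI : IsEmpty (Fin W.mordellWeilRank) := by rw [hr]; infer_instance
  convert Matrix.det_isEmpty (A := D.pairingMatrix P)

omit [W.IsGloballyMinimal] in
/-- **`#Ш_an` in rank `0`, explicitly.** If `rank_ℤ E(ℚ) = 0 = r_an`, `f` is the newform of `W` and
`ϖ · Ω(W) = Ω⁺_f`, then `#Ш_an = ϖ · [0]⁺_f · #E(ℚ)_tors² / ∏_ℓ c_ℓ ∈ ℚ`
(`L(E,1) = [0]⁺_f · Ω⁺_f`, `IsNewformOf.entireLFunction_one_eq`; `Reg = 1`,
`regulator_eq_one_of_finite`; `L^{(0)}(E,1)/0! = L(E,1)`). [cite: Miller2011LMS, §1] [cite: MazurTateTeitelbaum1986Invent, §I.8 (8.6)] -/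
theorem shaAn_eq_of_rankZero (hr : W.mordellWeilRank = 0) (han : W.analyticRank = 0) {N : ℕ}
    [NeZero N] {f : CuspForm (Gamma0 N) 2} (hf : IsNewformOf W f) (ϖ : ℚ)
    (hϖ : (ϖ : ℝ) * W.realPeriodRat = plusPeriod f) :
    shaAn W = ((ϖ * ratPlusSymbol f 0 * (W.torsionOrder : ℚ) ^ 2 / W.tamagawaProduct : ℚ) : ℂ) := by
  haveI : Finite W.toAffine.Point := W.mordellWeilRank_eq_zero_iff_finite.mp hr
  have hΩ : (0 : ℝ) < W.realPeriodRat := W.realPeriodRat_pos_holds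
  have hΩ0 : ((W.realPeriodRat : ℝ) : ℂ) ≠ 0 := by exact_mod_cast hΩ.ne'
  have hc0 : ((W.tamagawaProduct : ℕ) : ℂ) ≠ 0 := by exact_mod_cast W.tamagawaProduct_pos'.ne'
  rw [shaAn_def, W.leadingLCoeff_eq_of_analyticRank_eq_zero han, hf.entireLFunction_one_eq,
    W.regulator_eq_one_of_finite, ← hϖ]
  push_cast
  field_simp

/-! ## §2 The leading-term clause of `TwoAdicBSD` in rank `0` IS `#Ш = #Ш_an` -/

omit [W.IsGloballyMinimal] in
/-- Arithmetic core: both the `2`-adic side and the classical side reduce to the rational identity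
`ϖ · [0]⁺_f · #E(ℚ)_tors² = #Ш · ∏ c_ℓ`. Classical half. [folklore] -/
theorem shaAn_eq_shaOrder_iff_of_rankZero (hr : W.mordellWeilRank = 0) (han : W.analyticRank = 0)
    {N : ℕ} [NeZero N] {f : CuspForm (Gamma0 N) 2} (hf : IsNewformOf W f) (ϖ : ℚ)
    (hϖ : (ϖ : ℝ) * W.realPeriodRat = plusPeriod f) :
    shaAn W = W.shaOrder ↔
      ϖ * ratPlusSymbol f 0 * (W.torsionOrder : ℚ) ^ 2 = W.shaOrder * W.tamagawaProduct := by
  have hc0 : ((W.tamagawaProduct : ℕ) : ℚ) ≠ 0 := by exact_mod_cast W.tamagawaProduct_pos'.ne'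
  rw [shaAn_eq_of_rankZero W hr han hf ϖ hϖ]
  have hcast : (((ϖ * ratPlusSymbol f 0 * (W.torsionOrder : ℚ) ^ 2 / W.tamagawaProduct : ℚ) : ℂ) =
      (W.shaOrder : ℂ)) ↔
      (ϖ * ratPlusSymbol f 0 * (W.torsionOrder : ℚ) ^ 2 / W.tamagawaProduct : ℚ) = W.shaOrder := by
    constructor
    · intro h; exact_mod_cast h
    · intro h; rw [h]; push_cast; rfl
  rw [hcast, div_eq_iff hc0]

/-- `2`-adic half: MTT's clause (ii) at `p = 2` in rank `0` (coefficient `[T⁰]`, `log₂(γ)⁰ = 1`,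
`Reg₂(D) = 1`, `L₂(E,0) = (1 - α⁻¹)²[0]⁺_f`, `1 - α⁻¹ ≠ 0`) is the same rational identity.
[cite: MazurTateTeitelbaum1986Invent, §I.14 (14.3) and §II.10] -/
theorem twoAdicLeadingTerm_iff_of_rankZero (hord : IsOrdinaryAt W 2) (hr : W.mordellWeilRank = 0)
    {N : ℕ} [NeZero N] {f : CuspForm (Gamma0 N) 2} (hf : IsNewformOf W f)
    (D : PAdicHeightData W 2) (ϖ : ℚ) :
    ((ϖ : ℚ_[2]) * PowerSeries.coeff W.mordellWeilRank (padicLFunction f (unitRoot W 2 : ℚ_[2])) *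
          padicLog 2 (cyclotomicGenerator 2) ^ W.mordellWeilRank * (W.torsionOrder : ℚ_[2]) ^ 2 =
        (1 - (unitRoot W 2 : ℚ_[2])⁻¹) ^ 2 *
          (W.shaOrder * padicRegulator D * W.tamagawaProduct)) ↔
      ϖ * ratPlusSymbol f 0 * (W.torsionOrder : ℚ) ^ 2 = W.shaOrder * W.tamagawaProduct := by
  haveI : Fact (Nat.Prime 2) := ⟨Nat.prime_two⟩
  have hu : ((1 : ℚ_[2]) - ((unitRoot W 2 : ℤ_[2]) : ℚ_[2])⁻¹) ^ 2 ≠ 0 :=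
    pow_ne_zero _ (one_sub_unitRoot_inv_ne_zero W 2 hord)
  rw [hr, pow_zero, mul_one, PowerSeries.coeff_zero_eq_constantCoeff,
    constantCoeff_padicLFunction_unitRoot hord hf,
    padicRegulator_eq_one_of_mordellWeilRank_eq_zero W 2 hr D, mul_one]
  constructor
  · intro h
    have h' : ((1 : ℚ_[2]) - ((unitRoot W 2 : ℤ_[2]) : ℚ_[2])⁻¹) ^ 2 *
        ((ϖ : ℚ_[2]) * (ratPlusSymbol f 0 : ℚ_[2]) * (W.torsionOrder : ℚ_[2]) ^ 2) =
        ((1 : ℚ_[2]) - ((unitRoot W 2 : ℤ_[2]) : ℚ_[2])⁻¹) ^ 2 *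
        ((W.shaOrder : ℚ_[2]) * (W.tamagawaProduct : ℚ_[2])) := by
      rw [← h]; ring
    have h'' := mul_left_cancel₀ hu h'
    exact_mod_cast h''
  · intro h
    have h' : (ϖ : ℚ_[2]) * (ratPlusSymbol f 0 : ℚ_[2]) * (W.torsionOrder : ℚ_[2]) ^ 2 =
        (W.shaOrder : ℚ_[2]) * (W.tamagawaProduct : ℚ_[2]) := by exact_mod_cast h
    linear_combination ((1 : ℚ_[2]) - ((unitRoot W 2 : ℤ_[2]) : ℚ_[2])⁻¹) ^ 2 * h'

/-! ## §3 The calibration statement -/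

/-- **`TwoAdicBSD ⟹ #Ш = #Ш_an` in rank `0`.** For `E/ℚ` (globally minimal `W`) good ordinary at
`2` with `rank_ℤ E(ℚ) = 0 = r_an`, a newform `f` of `E` and its period ratio `ϖ` (`ϖ·Ω(W) = Ω⁺_f`):
if the `2`-adic BSD conjecture holds for SOME height datum `D`, then `Ш` finite ⇒ `#Ш_an = #Ш`
(the full classical formula, not only its `2`-part). [cite: MazurTateTeitelbaum1986Invent, §II.10] -/
theorem shaAn_eq_shaOrder_of_twoAdicBSD_of_rankZero (hord : IsOrdinaryAt W 2)
    (hr : W.mordellWeilRank = 0) (han : W.analyticRank = 0) {N : ℕ} [NeZero N]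
    {f : CuspForm (Gamma0 N) 2} (hf : IsNewformOf W f) (ϖ : ℚ)
    (hϖ : (ϖ : ℝ) * W.realPeriodRat = plusPeriod f) {D : PAdicHeightData W 2} (h : TwoAdicBSD W D)
    (hfin : Finite W.sha) : shaAn W = W.shaOrder := by
  haveI : Fact (Nat.Prime 2) := ⟨Nat.prime_two⟩
  have h2 := (h hord f hf).2 hfin ϖ hϖ
  exact (shaAn_eq_shaOrder_iff_of_rankZero W hr han hf ϖ hϖ).mpr
    ((twoAdicLeadingTerm_iff_of_rankZero W hord hr hf D ϖ).mp h2)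

omit [W.IsElliptic] [W.IsGloballyMinimal] in
/-- **`#Ш = #Ш_an ⟹ TwoAdicBSD` in rank `0`, for EVERY height datum.** Conversely, if
`rank_ℤ E(ℚ) = 0 = r_an` at a good ordinary `2` and (`Ш` finite ⇒ `#Ш_an = #Ш`), then MTT's
BSD(`2`) holds for every `D`: clause (i) by `order_padicLFunction_eq_zero_iff_analyticRank_eq_zero`,
clause (ii) by §2 (good ordinary reduction at `2` is a hypothesis INSIDE `TwoAdicBSD`, so it is
not repeated here). [cite: MazurTateTeitelbaum1986Invent, §II.10] -/
theorem twoAdicBSD_of_rankZero_of_shaAn_eq (hr : W.mordellWeilRank = 0)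
    (han : W.analyticRank = 0) (hBSD : Finite W.sha → shaAn W = W.shaOrder)
    (D : PAdicHeightData W 2) : TwoAdicBSD W D := by
  haveI : Fact (Nat.Prime 2) := ⟨Nat.prime_two⟩
  intro _ _ hord' N _ f hf
  refine ⟨?_, fun hfin ϖ hϖ => ?_⟩
  · rw [hr, Nat.cast_zero]
    exact (order_padicLFunction_eq_zero_iff_analyticRank_eq_zero W 2 hord' hf).mpr han
  · exact (twoAdicLeadingTerm_iff_of_rankZero W hord' hr hf D ϖ).mpr
      ((shaAn_eq_shaOrder_iff_of_rankZero W hr han hf ϖ hϖ).mp (hBSD hfin))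

/-- **CALIBRATION (rank `0`, good ordinary `2`): `TwoAdicBSD W D ⟺ (Ш finite ⇒ #Ш_an = #Ш)`**,
for every height datum `D`, given a newform `f` of `E` with its period ratio `ϖ` (both exist by
modularity: `ModularParametrizationData.exists_rat_mul_realPeriodRat_eq_plusPeriod`). On these rows
the E1 target carries exactly the information of the classical formula. [cite: MazurTateTeitelbaum1986Invent, §II.10] [cite: Disegni2020, §3.2.1] -/
theorem twoAdicBSD_iff_of_rankZero (hord : IsOrdinaryAt W 2) (hr : W.mordellWeilRank = 0)
    (han : W.analyticRank = 0) {N : ℕ} [NeZero N] {f : CuspForm (Gamma0 N) 2}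
    (hf : IsNewformOf W f) (ϖ : ℚ) (hϖ : (ϖ : ℝ) * W.realPeriodRat = plusPeriod f)
    (D : PAdicHeightData W 2) : TwoAdicBSD W D ↔ (Finite W.sha → shaAn W = W.shaOrder) :=
  ⟨fun h hfin => shaAn_eq_shaOrder_of_twoAdicBSD_of_rankZero W hord hr han hf ϖ hϖ h hfin,
    fun h => twoAdicBSD_of_rankZero_of_shaAn_eq W hr han h D⟩

/-- **Height-datum independence in rank `0`**: `TwoAdicBSD W D ⟺ TwoAdicBSD W D'` (the caveat of
`PAdicBSDConjecture` about non-canonical data is void in rank `0`). [folklore] -/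
theorem twoAdicBSD_iff_twoAdicBSD_of_rankZero (hord : IsOrdinaryAt W 2) (hr : W.mordellWeilRank = 0)
    (han : W.analyticRank = 0) {N : ℕ} [NeZero N] {f : CuspForm (Gamma0 N) 2}
    (hf : IsNewformOf W f) (ϖ : ℚ) (hϖ : (ϖ : ℝ) * W.realPeriodRat = plusPeriod f)
    (D D' : PAdicHeightData W 2) : TwoAdicBSD W D ↔ TwoAdicBSD W D' := by
  rw [twoAdicBSD_iff_of_rankZero W hord hr han hf ϖ hϖ D,
    twoAdicBSD_iff_of_rankZero W hord hr han hf ϖ hϖ D']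

/-- **With Gross–Zagier–Kolyvagin** (`hGZK`, published): on an `r_an = 0` row `Ш` is finite and
the rank is `0`, so `TwoAdicBSD W D ⟺ #Ш_an = #Ш` outright. [folklore] -/
theorem twoAdicBSD_iff_shaAn_eq_of_analyticRank_eq_zero
    (hGZK : rank_eq_analyticRank_of_analyticRank_le_one) (hord : IsOrdinaryAt W 2)
    (han : W.analyticRank = 0) {N : ℕ} [NeZero N] {f : CuspForm (Gamma0 N) 2}
    (hf : IsNewformOf W f) (ϖ : ℚ) (hϖ : (ϖ : ℝ) * W.realPeriodRat = plusPeriod f)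
    (D : PAdicHeightData W 2) : TwoAdicBSD W D ↔ shaAn W = W.shaOrder := by
  have hle : W.analyticRank ≤ 1 := by rw [han]; exact zero_le_one
  have hr : W.mordellWeilRank = 0 := by rw [(hGZK W hle).1, han]
  have hfin : Finite W.sha := (hGZK W hle).2
  rw [twoAdicBSD_iff_of_rankZero W hord hr han hf ϖ hϖ D]
  exact ⟨fun h => h hfin, fun h _ => h⟩

end Summit.BirchSwinnertonDyer.Rank1Residual.X5.O1

end
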